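import Summits.CriticalPhenomena.SAWScalingLimit.Theorems.SAWSpinMonotoneQCIdentificationXiLift
import Summits.CriticalPhenomena.SAWScalingLimit.Theorems.SAWSpinMonotoneQCIdentificationLocalPower
import Summits.CriticalPhenomena.SAWScalingLimit.Theorems.SAWSpinMonotoneQCIdentificationStokes

/-!
# Smirnov's primitive `Ξ = F^{8/5} dz`, II: the single-valued port powers, the 1-form and its
Stokes defect (helper sub-goals (B′), (D) of `stub_rayCondition`, line `eight_fifths_primitive`,
crux `QCIdentification`, stmt-CriticalPhenomena-16772)

**Setting.** As in `…XiLift`: `F = Fobs Λ a`, `S_v = modeSum F v`, `a′_v = P85.bratio F v` the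
Beltrami ratio (`‖a′_v‖ < 1` under (K)), port values `F(p_k) = (S_v/3)(1 + ω^k a′_v)`
(`P85.p85_port_factor`), and a real function `Θ` on faces (the lifted argument of
`xi_exists_argLift`: `Θ_w - Θ_v = arg (S_w/S_v)` across adjacent faces of the source component
`Λ₀`, `Θ_v ≡ arg S_v`).

**What.**

* `locConst F Θ v = (‖S_v‖/3)^{8/5} e^{i(8/5)Θ_v}` — the local constant, `‖L_v‖ = (‖S_v‖/3)^{8/5}`
  (`norm_locConst`), `L_v⁵ = (S_v/3)⁸` when `Θ_v ≡ arg S_v` (`locConst_pow_five`);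
* `portPow F Θ v k = L_v · (1 + ω^k a′_v)^{8/5}` (principal power) — the port powers,
  `= (‖S_v‖‖A‖/3)^{8/5} e^{i(8/5)(Θ_v + arg A)}`, `A = 1 + ω^k a′_v` (`portPow_eq_polar`), and
  `portPow⁵ = F(p_k)⁸` (registered `xi_portPow_pow_five`);
* **single-valuedness** (registered `xi_portPower_shared`): if `w = hexNbr v k ∈ Λ` and
  `Θ_w - Θ_v = arg (S_w/S_v)`, then `portPow F Θ w k = portPow F Θ v k` — both are the `8/5`-th power
  of the common port value `F{v, w} = (S_v/3)A_v = (S_w/3)A_w` on the branch through `Θ`: the moduli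
  agree and `Θ_v + arg A_v = Θ_w + arg A_w` EXACTLY, because
  `arg (S_w/S_v) = arg (A_v/A_w) = arg A_v - arg A_w` for `A_v, A_w` in the right half-plane;
* the discrete 1-form `dXi F Θ v k = portPow F Θ v k · (z_{k+1} - z_k)` on the `𝕋`-edge
  `[triVert v k, triVert v (k+1)]` crossed by the port `k` is ANTISYMMETRIC across interior mid-edges
  of `Λ₀` (`dXi_add_dXi_hexNbr`), so (registered `xi_stokes_defect_bound`, discrete Stokes
  `Stokes.st_sum_ports_eq_sum_boundary_ports`) the total of `Ξ` over the BOUNDARY ports of `Λ₀`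
  equals the sum of the face circulations `Σ_k dXi v k = faceSign v · ω · L_v · circ a′_v`, each of
  norm `≤ 3·2^{8/5} (‖S_v‖/3)^{8/5} ‖a′_v‖²` (`P85.p85_oneForm_circulation_norm_le`).

Validated by exact enumeration (`work/stubs/scratch_xi/xi_check.py`, 83 instances: single-valuedness
residual ≤ 3e-13, Stokes residual ≤ 2e-13).

Sources: S. Smirnov, *Towards conformal invariance of 2D lattice models*, Proc. ICM 2006
(arXiv:0708.0032) §5.6 (the primitive `∫ F^{1/σ} dz`); H. Duminil-Copin, S. Smirnov, Ann. of Math.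
175 (2012) 1653–1665 (arXiv:1007.0575), Lemma 1; stub report `STUB-REPORT-rayCondition.md` ((B), (D)).
-/

noncomputable section

open Complex
open Literature.Probability.LatticeModels Literature.Probability.RandomPlanarGeometry
open Literature.Probability.RandomPlanarGeometry.SAW
open Literature.Barriers.CriticalPhenomena
open Summit.CriticalPhenomena.SAWScalingLimit.Theses.SAWDevelopingMap

namespace Summit.CriticalPhenomena.SAWScalingLimit.Cruxes.QCIdentification.EightFifthsPrimitive

namespace Xi

open NB Dev P85 Stokes

/-! ### Polar forms -/

/-- **Principal real powers in polar form**: `z^c = ‖z‖^c · e^{i c arg z}` for `z ≠ 0`, `c` real. -/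
theorem cpow_ofReal_eq_polar {z : ℂ} (hz : z ≠ 0) (c : ℝ) :
    z ^ (c : ℂ) = ((‖z‖ ^ c : ℝ) : ℂ) * exp (((c * arg z : ℝ) : ℂ) * I) := by
  rw [cpow_def_of_ne_zero hz, Real.rpow_def_of_pos (norm_pos_iff.2 hz), Complex.ofReal_exp,
    ← Complex.exp_add]
  congr 1
  unfold Complex.log
  push_cast
  ring

/-- The product of two polar forms with the same exponent. -/
theorem polar_mul_polar {r₁ r₂ : ℝ} (h₁ : 0 ≤ r₁) (h₂ : 0 ≤ r₂) (c t₁ t₂ : ℝ) :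
    ((r₁ ^ c : ℝ) : ℂ) * exp (((c * t₁ : ℝ) : ℂ) * I) * (((r₂ ^ c : ℝ) : ℂ) * exp (((c * t₂ : ℝ) : ℂ) * I)) =
      (((r₁ * r₂) ^ c : ℝ) : ℂ) * exp (((c * (t₁ + t₂) : ℝ) : ℂ) * I) := by
  rw [Real.mul_rpow h₁ h₂]
  have he : exp (((c * (t₁ + t₂) : ℝ) : ℂ) * I) =
      exp (((c * t₁ : ℝ) : ℂ) * I) * exp (((c * t₂ : ℝ) : ℂ) * I) := by
    rw [← Complex.exp_add]
    congr 1
    push_cast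
    ring
  rw [he]
  push_cast
  ring

/-- A real lift of the argument reproduces the number: `‖z‖ e^{it} = z` when `t ≡ arg z`. -/
theorem norm_mul_exp_of_coe_eq_arg {z : ℂ} {t : ℝ} (h : (t : Real.Angle) = arg z) :
    (‖z‖ : ℂ) * exp ((t : ℂ) * I) = z := by
  obtain ⟨n, hn⟩ := Real.Angle.angle_eq_iff_two_pi_dvd_sub.1 h
  have ht : exp ((t : ℂ) * I) = exp ((arg z : ℂ) * I) := by
    refine Complex.exp_eq_exp_iff_exists_int.2 ⟨n, ?_⟩
    have : t = arg z + 2 * Real.pi * n := by linarith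
    rw [this]
    push_cast
    ring
  rw [ht, norm_mul_exp_arg_mul_I]

/-! ### The local constant -/

/-- The **local constant** `L_v = (‖S_v‖/3)^{8/5} e^{i(8/5)Θ_v}` of the face `v` for the lifted
argument `Θ`. -/
def locConst (F : Sym2 HexVertex → ℂ) (Θ : HexVertex → ℝ) (v : HexVertex) : ℂ :=
  (((‖modeSum F v‖ / 3) ^ ((8 : ℝ) / 5) : ℝ) : ℂ) * exp ((((8 : ℝ) / 5 * Θ v : ℝ) : ℂ) * I)

/-- `‖L_v‖ = (‖S_v‖/3)^{8/5}`. -/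
theorem norm_locConst (F : Sym2 HexVertex → ℂ) (Θ : HexVertex → ℝ) (v : HexVertex) :
    ‖locConst F Θ v‖ = (‖modeSum F v‖ / 3) ^ ((8 : ℝ) / 5) := by
  rw [locConst, norm_mul, Complex.norm_exp_ofReal_mul_I, mul_one, Complex.norm_real,
    Real.norm_of_nonneg (Real.rpow_nonneg (by positivity) _)]

/-- **`L_v⁵ = (S_v/3)⁸`** as soon as `Θ_v ≡ arg S_v (mod 2π)`. -/
theorem locConst_pow_five {F : Sym2 HexVertex → ℂ} {Θ : HexVertex → ℝ} {v : HexVertex}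
    (h : (Θ v : Real.Angle) = arg (modeSum F v)) :
    locConst F Θ v ^ 5 = (modeSum F v / 3) ^ 8 := by
  have hS := norm_mul_exp_of_coe_eq_arg h
  have hr : 0 ≤ ‖modeSum F v‖ / 3 := by positivity
  have h1 : ((‖modeSum F v‖ / 3) ^ ((8 : ℝ) / 5)) ^ (5 : ℕ) = (‖modeSum F v‖ / 3) ^ (8 : ℕ) := by
    rw [← Real.rpow_mul_natCast hr, ← Real.rpow_natCast]
    norm_num
  have h2 : exp ((((8 : ℝ) / 5 * Θ v : ℝ) : ℂ) * I) ^ 5 = exp ((Θ v : ℂ) * I) ^ 8 := by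
    rw [← Complex.exp_nat_mul, ← Complex.exp_nat_mul]
    congr 1
    push_cast
    ring
  conv_rhs => rw [← hS]
  rw [locConst, mul_pow, ← Complex.ofReal_pow, h1, h2]
  push_cast
  ring

/-! ### The port powers -/

/-- The **port power** `f_k(v) = L_v · (1 + ω^k a′_v)^{8/5}` (principal power, `a′ = P85.bratio`):
the value of `F^{8/5}` on the port `k` of `v` on the branch through `Θ`. -/
def portPow (F : Sym2 HexVertex → ℂ) (Θ : HexVertex → ℝ) (v : HexVertex) (k : Fin 3) : ℂ :=
  locConst F Θ v * (1 + omg ^ (k : ℕ) * bratio F v) ^ ((8 : ℂ) / 5)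

/-- `(8 : ℂ)/5` is the real number `8/5`. -/
theorem eight_fifths_eq : ((8 : ℂ) / 5) = (((8 : ℝ) / 5 : ℝ) : ℂ) := by
  push_cast
  ring

/-- **Polar form of the port power**: `f_k(v) = (‖S_v‖/3 · ‖A‖)^{8/5} e^{i(8/5)(Θ_v + arg A)}`,
`A = 1 + ω^k a′_v ≠ 0`. -/
theorem portPow_eq_polar (F : Sym2 HexVertex → ℂ) (Θ : HexVertex → ℝ) (v : HexVertex) (k : Fin 3)
    (hA : 1 + omg ^ (k : ℕ) * bratio F v ≠ 0) :
    portPow F Θ v k = (((‖modeSum F v‖ / 3 * ‖1 + omg ^ (k : ℕ) * bratio F v‖) ^ ((8 : ℝ) / 5) : ℝ) : ℂ) *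
      exp ((((8 : ℝ) / 5 * (Θ v + arg (1 + omg ^ (k : ℕ) * bratio F v)) : ℝ) : ℂ) * I) := by
  rw [portPow, eight_fifths_eq, cpow_ofReal_eq_polar hA, locConst,
    polar_mul_polar (by positivity) (norm_nonneg _)]

/-- The port factor `A = 1 + ω^k a′` lies in the open right half-plane when `‖a′‖ < 1`. -/
theorem one_add_omg_pow_mul_re_pos {a' : ℂ} (ha : ‖a'‖ < 1) (k : Fin 3) :
    0 < (1 + omg ^ (k : ℕ) * a').re := by
  rw [mul_comm]
  exact one_add_mul_re_pos ha (norm_omg_pow _)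

variable {Λ : Finset HexVertex} {a : Sym2 HexVertex}

/-- **`f_k⁵ = F(p_k)⁸` (registered).** Under `NoFoldBound`, at a face `v ∈ Λ` of a simply connected
domain with boundary source, with `S_v ≠ 0` and `Θ_v ≡ arg S_v`, the port powers are a consistent
`8/5`-th power of the port values: `(portPow F Θ v k)⁵ = F{v, hexNbr v k}⁸`. -/
theorem xi_portPow_pow_five : NoFoldBound → ∀ {Λ : Finset HexVertex}, hexDomainSimplyConnected Λ → ∀ {a : Sym2 HexVertex}, a ∈ hexDomainBoundary Λ → ∀ (Θ : HexVertex → ℝ) {v : HexVertex}, v ∈ Λ → modeSum (Fobs Λ a) v ≠ 0 → (Θ v : Real.Angle) = Complex.arg (modeSum (Fobs Λ a) v) → ∀ k : Fin 3, Xi.portPow (Fobs Λ a) Θ v k ^ 5 = Fobs Λ a s(v, hexNbr v k) ^ 8 := by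
  intro hK Λ hΛ a ha Θ v hv hS hΘ k
  rw [portPow, localPower_pow_five _ _ _ k (locConst_pow_five hΘ), ← p85_port_factor Λ hΛ ha hv hS k]

/-- **Single-valuedness of the port powers across a shared mid-edge (registered).** Under
`NoFoldBound`, in a simply connected domain with boundary source, let `v` and `w = hexNbr v k` be
faces of `Λ` with non-zero `∂H`-modes and let `Θ` have the increment `Θ_w - Θ_v = arg (S_w/S_v)`.
Then the two port powers attached to the common mid-edge `{v, w}` (port `k` of `v` and port `k` of
`w`, `hexNbr w k = v`) coincide: `portPow F Θ w k = portPow F Θ v k`. -/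
theorem xi_portPower_shared : NoFoldBound → ∀ {Λ : Finset HexVertex}, hexDomainSimplyConnected Λ → ∀ {a : Sym2 HexVertex}, a ∈ hexDomainBoundary Λ → ∀ (Θ : HexVertex → ℝ) {v : HexVertex} (k : Fin 3), v ∈ Λ → hexNbr v k ∈ Λ → modeSum (Fobs Λ a) v ≠ 0 → modeSum (Fobs Λ a) (hexNbr v k) ≠ 0 → Θ (hexNbr v k) - Θ v = Complex.arg (modeSum (Fobs Λ a) (hexNbr v k) / modeSum (Fobs Λ a) v) → Xi.portPow (Fobs Λ a) Θ (hexNbr v k) k = Xi.portPow (Fobs Λ a) Θ v k := by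
  intro hK Λ hΛ a ha Θ v k hv hw hSv hSw hΘ
  set w := hexNbr v k with hwdef
  set Av := 1 + omg ^ (k : ℕ) * bratio (Fobs Λ a) v with hAv
  set Aw := 1 + omg ^ (k : ℕ) * bratio (Fobs Λ a) w with hAw
  have hvA : 0 < Av.re := one_add_omg_pow_mul_re_pos (p85_norm_bratio_lt_one hK hΛ ha hv hSv) k
  have hwA : 0 < Aw.re := one_add_omg_pow_mul_re_pos (p85_norm_bratio_lt_one hK hΛ ha hw hSw) k
  have hvA0 : Av ≠ 0 := Complex.ne_zero_of_re_pos hvA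
  have hwA0 : Aw ≠ 0 := Complex.ne_zero_of_re_pos hwA
  -- the common port value
  have hpv := p85_port_factor Λ hΛ ha hv hSv k
  have hpw := p85_port_factor Λ hΛ ha hw hSw k
  rw [show s(w, hexNbr w k) = s(v, hexNbr v k) by rw [hwdef, hexNbr_hexNbr, Sym2.eq_swap]] at hpw
  have hprod : modeSum (Fobs Λ a) w * Aw = modeSum (Fobs Λ a) v * Av := by
    have h := hpv.symm.trans hpw
    rw [hAv, hAw]
    linear_combination (-3 : ℂ) * h
  -- moduli
  have hnorm : ‖modeSum (Fobs Λ a) w‖ / 3 * ‖Aw‖ = ‖modeSum (Fobs Λ a) v‖ / 3 * ‖Av‖ := by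
    have h := congrArg (fun z : ℂ => ‖z‖) hprod
    simp only [norm_mul] at h
    linear_combination h / 3
  -- phases, exactly
  have hdiv : modeSum (Fobs Λ a) w / modeSum (Fobs Λ a) v = Av / Aw := by
    rw [div_eq_div_iff hSv hwA0, hprod, mul_comm]
  have hphase : Θ w + arg Aw = Θ v + arg Av := by
    rw [hdiv, arg_div_of_re_pos hvA hwA] at hΘ
    linarith
  rw [portPow_eq_polar _ _ _ _ hwA0, portPow_eq_polar _ _ _ _ hvA0]
  simp only [← hAv, ← hAw]
  rw [hnorm, hphase]

/-! ### The discrete 1-form `Ξ` and its Stokes defect -/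

/-- The **discrete 1-form `Ξ = F^{8/5} dz`** on the port `k` of the face `v`: the port power times the
edge vector of the `𝕋`-edge `[triVert v k, triVert v (k+1)]` crossed by the port. -/
def dXi (F : Sym2 HexVertex → ℂ) (Θ : HexVertex → ℝ) (v : HexVertex) (k : Fin 3) : ℂ :=
  portPow F Θ v k * (triEmbed (triVert v (k + 1)) - triEmbed (triVert v k))

/-- **`Ξ` is antisymmetric across a shared mid-edge** as soon as the two port powers agree (the
shared `𝕋`-edge is traversed in opposite directions, `Stokes.triVert_hexNbr`). -/
theorem dXi_add_dXi_hexNbr {F : Sym2 HexVertex → ℂ} {Θ : HexVertex → ℝ} {v : HexVertex} {k : Fin 3}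
    (h : portPow F Θ (hexNbr v k) k = portPow F Θ v k) :
    dXi F Θ v k + dXi F Θ (hexNbr v k) k = 0 := by
  rw [dXi, dXi, h, triVert_hexNbr, triVert_hexNbr_succ]
  ring

/-- **The face circulation of `Ξ`**: `Σ_k dXi v k = faceSign v · ω · L_v · circ a′_v`. -/
theorem sum_dXi_eq (F : Sym2 HexVertex → ℂ) (Θ : HexVertex → ℝ) (v : HexVertex) :
    ∑ k : Fin 3, dXi F Θ v k = faceSign v * omg * (locConst F Θ v * circ (bratio F v)) := by
  simp only [dXi, portPow]
  rw [sum_mul_edge_eq v (fun k => locConst F Θ v * (1 + omg ^ (k : ℕ) * bratio F v) ^ ((8 : ℂ) / 5)),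
    p85_circulation_eq]

/-- **The face circulation of `Ξ` is quadratically small in the Beltrami ratio**:
`‖Σ_k dXi v k‖ ≤ 3·2^{8/5} (‖S_v‖/3)^{8/5} ‖a′_v‖²` when `‖a′_v‖ < 1`. -/
theorem norm_sum_dXi_le {F : Sym2 HexVertex → ℂ} (Θ : HexVertex → ℝ) {v : HexVertex}
    (ha : ‖bratio F v‖ < 1) :
    ‖∑ k : Fin 3, dXi F Θ v k‖ ≤
      3 * 2 ^ ((8 : ℝ) / 5) * (‖modeSum F v‖ / 3) ^ ((8 : ℝ) / 5) * ‖bratio F v‖ ^ 2 := by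
  have h := p85_oneForm_circulation_norm_le v (bratio F v) (locConst F Θ v) ha
  rw [norm_locConst] at h
  simpa only [dXi, portPow] using h

variable {ua va : HexVertex}

/-- **Discrete Stokes for `Ξ` on the source component, with the defect bound (registered).** Under
`NoFoldBound`, for a simply connected `Λ` with boundary source `{ua, va}` and a function `Θ` with
the increments `arg (S_w/S_v)` across adjacent faces of `Λ₀ = NB.srcComp Λ va` (as produced by
`xi_exists_argLift`): the total of `Ξ` over the BOUNDARY ports of `Λ₀` (far endpoint outside `Λ₀`)
equals the sum over `v ∈ Λ₀` of the face circulations `Σ_k dXi v k`, and each face circulation has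
norm at most `3·2^{8/5} (‖S_v‖/3)^{8/5} ‖a′_v‖²`. -/
theorem xi_stokes_defect_bound : NoFoldBound → ∀ {Λ : Finset HexVertex}, hexDomainSimplyConnected Λ → ∀ {ua va : HexVertex}, va ∈ Λ → ua ∉ Λ → hexGraph.Adj va ua → ∀ (Θ : HexVertex → ℝ), (∀ v ∈ NB.srcComp Λ va, ∀ w ∈ NB.srcComp Λ va, hexGraph.Adj v w → Θ w - Θ v = Complex.arg (modeSum (Fobs Λ s(ua, va)) w / modeSum (Fobs Λ s(ua, va)) v)) → (∑ v ∈ NB.srcComp Λ va, ∑ k : Fin 3, (if hexNbr v k ∈ NB.srcComp Λ va then 0 else Xi.dXi (Fobs Λ s(ua, va)) Θ v k)) = ∑ v ∈ NB.srcComp Λ va, ∑ k : Fin 3, Xi.dXi (Fobs Λ s(ua, va)) Θ v k ∧ ∀ v ∈ NB.srcComp Λ va, ‖∑ k : Fin 3, Xi.dXi (Fobs Λ s(ua, va)) Θ v k‖ ≤ 3 * 2 ^ ((8 : ℝ) / 5) * (‖modeSum (Fobs Λ s(ua, va)) v‖ / 3) ^ ((8 : ℝ) / 5) * ‖P85.bratio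 (Fobs Λ s(ua, va)) v‖ ^ 2 := by
  intro hK Λ hΛ ua va hva hua hadj Θ hΘ
  have ha : s(ua, va) ∈ hexDomainBoundary Λ := mk_mem_boundary hva hua hadj
  refine ⟨(st_sum_ports_eq_sum_boundary_ports (srcComp Λ va) (dXi (Fobs Λ s(ua, va)) Θ)
    fun v hv k hw => ?_).symm, fun v hv => ?_⟩
  · refine dXi_add_dXi_hexNbr (xi_portPower_shared hK hΛ ha Θ k (srcComp_subset hv)
      (srcComp_subset hw) (modeSum_ne_zero_of_mem_srcComp hK hΛ hua hadj hv)
      (modeSum_ne_zero_of_mem_srcComp hK hΛ hua hadj hw) ?_)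
    exact hΘ v hv (hexNbr v k) hw (adj_hexNbr v k)
  · exact norm_sum_dXi_le Θ (p85_norm_bratio_lt_one hK hΛ ha (srcComp_subset hv)
      (modeSum_ne_zero_of_mem_srcComp hK hΛ hua hadj hv))

/-- **Corollary: the total boundary increment of `Ξ` is bounded by the bulk defect.** -/
theorem norm_sum_boundary_dXi_le (hK : NoFoldBound) (hΛ : hexDomainSimplyConnected Λ)
    (hva : va ∈ Λ) (hua : ua ∉ Λ) (hadj : hexGraph.Adj va ua) (Θ : HexVertex → ℝ)
    (hΘ : ∀ v ∈ srcComp Λ va, ∀ w ∈ srcComp Λ va, hexGraph.Adj v w →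
      Θ w - Θ v = arg (modeSum (Fobs Λ s(ua, va)) w / modeSum (Fobs Λ s(ua, va)) v)) :
    ‖∑ v ∈ srcComp Λ va, ∑ k : Fin 3,
        (if hexNbr v k ∈ srcComp Λ va then 0 else dXi (Fobs Λ s(ua, va)) Θ v k)‖ ≤
      ∑ v ∈ srcComp Λ va, 3 * 2 ^ ((8 : ℝ) / 5) *
        (‖modeSum (Fobs Λ s(ua, va)) v‖ / 3) ^ ((8 : ℝ) / 5) * ‖bratio (Fobs Λ s(ua, va)) v‖ ^ 2 := by
  obtain ⟨hst, hle⟩ := xi_stokes_defect_bound hK hΛ hva hua hadj Θ hΘ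
  rw [hst]
  exact (norm_sum_le _ _).trans (Finset.sum_le_sum hle)

end Xi

end Summit.CriticalPhenomena.SAWScalingLimit.Cruxes.QCIdentification.EightFifthsPrimitive

end
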